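import Summits.CriticalPhenomena.CardyFormulaZ2.Theorems.CardySelfDualSegmentUniformMarginalityTargetGivesPointwise

/-!
# RESTATEMENT CERTIFICATE II (workfile, not a proposal) — route `CardySelfDualSegment` with the crux
# `UniformBoxCrossing` weakened to POINTWISE box crossing of the single corner models

Lead prover-line-stmt-CriticalPhenomena-5472-c11-0 (crux stmt-CriticalPhenomena-5472, line `Sketch`).  Companion of
`Lines/Sketch_restatement.lean` (lead c2: UM ↦ UM_rect, SegmentOpen ↦ SegmentOpen_rect, SegmentClosed proved).  This file
spells out, in the EXACT `let`-style of the gate-written route file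
`Summits/CriticalPhenomena/CardyFormulaZ2/Theses/CardySelfDualSegment.lean`, the proposed POINTWISE restatement of the crux
`UniformBoxCrossing` (stmt-CriticalPhenomena-5476),

* `PointwiseBoxCrossing` : every single corner model `M_t` has the box-crossing (RSW) property — constants may depend on `t`
  (one Bollobás–Riordan-Conjecture-8.2 instance per `t`; classical at `t = 0` (site-𝕋) and `t = 1` (bond-ℤ²)),

and CHECKS against the tree (after p157143 `…UniformMarginalityPointwiseBoxCrossing.lean`, p157891
`…UniformMarginalityTargetGivesPointwise.lean`):

* `pointwiseBoxCrossing_of_uniform : UniformBoxCrossing → PointwiseBoxCrossing` — the restated crux is WEAKER;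
* `uniformBoxCrossing_of_pointwise : UniformMarginalityRect → PointwiseBoxCrossing → UniformBoxCrossing` — and loses nothing
  given the (restated) marginality crux (the t-uniformity merger `stub_uniformityMerger`, compactness of `[0,1]`);
* `closesRectPointwise : SegmentOpenRect → UniformMarginalityRect → PointwiseBoxCrossing → SmirnovBasePoint → QuarterTurnPinning →
  CrudeToCanonical → CardyFormulaZ2` — the restated deciding theorem with BOTH restatements (c2's and this one);
* `pointwiseBoxCrossing_of_target : Target → PointwiseBoxCrossing` — the restated crux is NECESSARY for the route's own Target
  (`hasBoxCrossingProperty_of_target`), so it carries no risk beyond the thesis.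
`UniformMarginalityRect`, `SegmentOpenRect` are c2's texts (repeated verbatim so that this file is self-contained).
-/

noncomputable section

namespace Summit.CriticalPhenomena.CardyFormulaZ2.Cruxes.UniformMarginality.HeatFlow.RestatementPointwise

open Filter Set MeasureTheory
open Summit.CriticalPhenomena.CardyFormulaZ2.Theses.CardySelfDualSegment
open Summit.CriticalPhenomena.CardyFormulaZ2.Theorems (smirnovBasePoint_proof quarterTurnPinning_proof)

/-- RESTATED CRUX (proposed text for item stmt-CriticalPhenomena-5476): POINTWISE A-PRIORI THEORY — for every t ∈ [0,1]
the law of M_t drawn on √2ℤ² has the box-crossing (RSW) property `HasBoxCrossingProperty`: for every aspect ratio ρ > 0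
there are c > 0 and n₀ (depending on t and ρ) with `BoxCrossingBounds`. -/
def PointwiseBoxCrossing : Prop :=
  let prm : unitInterval → Literature.Probability.LatticeModels.Site 2 × Fin 2 → unitInterval := fun t i => if i.2 = 0 then Literature.Probability.Percolation.half else Literature.Probability.Percolation.half * t; let cfg : Set (Literature.Probability.LatticeModels.Site 2 × Fin 2) → Literature.Probability.Percolation.BondConfig (Literature.Probability.LatticeModels.Site 2) := fun S => {e | ∃ v : Literature.Probability.LatticeModels.Site 2, (e = s(v, v + ![1, 0]) ∧ (v, (0 : Fin 2)) ∈ S) ∨ (e = s(v, v + ![0, 1]) ∧ ((v, (0 : Fin 2)) ∈ S ↔ (v, (1 : Fin 2)) ∉ S))}; (∀ t : unitInterval, Literature.Probability.LatticeModels.HasBoxCrossingProperty ((Literature.Probability.LatticeModels.prodBernoulli (prm t)).map cfg) Literature.Probability.LatticeModels.squareLatticeEmbedding.z)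

/-- c2's RESTATED marginality crux UM_rect (text of `Lines/Sketch_restatement.lean`, repeated verbatim). -/
def UniformMarginalityRect : Prop :=
  let prm : unitInterval → Literature.Probability.LatticeModels.Site 2 × Fin 2 → unitInterval := fun t i => if i.2 = 0 then Literature.Probability.Percolation.half else Literature.Probability.Percolation.half * t; let cfg : Set (Literature.Probability.LatticeModels.Site 2 × Fin 2) → Literature.Probability.Percolation.BondConfig (Literature.Probability.LatticeModels.Site 2) := fun S => {e | ∃ v : Literature.Probability.LatticeModels.Site 2, (e = s(v, v + ![1, 0]) ∧ (v, (0 : Fin 2)) ∈ S) ∨ (e = s(v, v + ![0, 1]) ∧ ((v, (0 : Fin 2)) ∈ S ↔ (v, (1 : Fin 2)) ∉ S))}; let P : unitInterval → Literature.Probability.RandomPlanarGeometry.ConformalRectangle → ℝ → ℝ := fun t R δ => (Literature.Probability.LatticeModels.prodBernoulli (prm t)).real {S | cfg S ∈ Literature.Probability.Percolation.embDomainCrossing Literature.Probability.LatticeModels.squareLatticeEmbedding.z R.carrier δ (R.arc 0) (R.arc 2)}; (∀ (t₀ : unitInterval) (R : Literature.Probability.RandomPlanarGeometry.ConformalRectangle),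 (∃ S : Finset (ℂ × ℂ), (∀ p ∈ S, p.1.re = p.2.re ∨ p.1.im = p.2.im) ∧ frontier R.carrier ⊆ ⋃ p ∈ S, segment ℝ p.1 p.2) → ∀ (ε : ℝ), 0 < ε → ∃ η > 0, ∀ t : unitInterval, dist t t₀ < η → ∀ δ : ℝ, 0 < δ → |P t R δ - P t₀ R δ| < ε)

/-- c2's RESTATED `SegmentOpen` (text of `Lines/Sketch_restatement.lean`, repeated verbatim). -/
def SegmentOpenRect : Prop :=
  let prm : unitInterval → Literature.Probability.LatticeModels.Site 2 × Fin 2 → unitInterval := fun t i => if i.2 = 0 then Literature.Probability.Percolation.half else Literature.Probability.Percolation.half * t; let cfg : Set (Literature.Probability.LatticeModels.Site 2 × Fin 2) → Literature.Probability.Percolation.BondConfig (Literature.Probability.LatticeModels.Site 2) := fun S => {e | ∃ v : Literature.Probability.LatticeModels.Site 2, (e = s(v, v + ![1, 0]) ∧ (v, (0 : Fin 2)) ∈ S) ∨ (e = s(v, v + ![0, 1]) ∧ ((v, (0 : Fin 2)) ∈ S ↔ (v, (1 : Fin 2)) ∉ S))}; let P : unitInterval → Literature.Probability.RandomPlanarGeometry.ConformalRectangle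 → ℝ → ℝ := fun t R δ => (Literature.Probability.LatticeModels.prodBernoulli (prm t)).real {S | cfg S ∈ Literature.Probability.Percolation.embDomainCrossing Literature.Probability.LatticeModels.squareLatticeEmbedding.z R.carrier δ (R.arc 0) (R.arc 2)}; let CardyMod : unitInterval → ℂ → Prop := fun t α => ∀ (R R' : Literature.Probability.RandomPlanarGeometry.ConformalRectangle) (φ : Literature.Probability.RandomPlanarGeometry.ConformalEquiv UpperHalfPlane.upperHalfPlaneSet R.carrier) (x : Fin 4 → ℝ), R.carrier = Literature.Barriers.CriticalPhenomena.moduliShear α '' R'.carrier → (∀ i, R.pt i = Literature.Barriers.CriticalPhenomena.moduliShear α (R'.pt i)) → R.IsUniformizing φ x → Filter.Tendsto (P t R') (nhdsWithin 0 (Set.Ioi 0)) (nhds (Literature.Probability.RandomPlanarGeometry.cardyFunction (Literature.Probability.RandomPlanarGeometry.crossRatio x))); let G : Set unitInterval := {t | ∃ α : ℂ, 0 < α.im ∧ CardyMod t α}; (∀ (t₀ : unitInterval) (R : Literature.Probability.RandomPlanarGeometry.ConformalRectangle), (∃ S : Finset (ℂ × ℂ), (∀ p ∈ S, p.1.re =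 p.2.re ∨ p.1.im = p.2.im) ∧ frontier R.carrier ⊆ ⋃ p ∈ S, segment ℝ p.1 p.2) → ∀ (ε : ℝ), 0 < ε → ∃ η > 0, ∀ t : unitInterval, dist t t₀ < η → ∀ δ : ℝ, 0 < δ → |P t R δ - P t₀ R δ| < ε) → IsOpen G

/-- The restated crux is WEAKER than the filed one. -/
theorem pointwiseBoxCrossing_of_uniform (h : UniformBoxCrossing) : PointwiseBoxCrossing :=
  hasBoxCrossingProperty_of_uniformBoxCrossing h

/-- … and loses nothing given UM_rect (the t-uniformity merger `stub_uniformityMerger`, p157143). -/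
theorem uniformBoxCrossing_of_pointwise (hM : UniformMarginalityRect) (hP : PointwiseBoxCrossing) :
    UniformBoxCrossing :=
  uniformBoxCrossing_of_uniformMarginalityRect_of_pointwise hM hP

/-- The restated crux is NECESSARY for the route's own `Target` (p157891). -/
theorem pointwiseBoxCrossing_of_target (hT : Target) : PointwiseBoxCrossing :=
  hasBoxCrossingProperty_of_target hT

/-- THE RESTATED DECIDING THEOREM with both restatements (c2's rectilinear marginality and pointwise box crossing):
SegmentOpen_rect → UM_rect → PointwiseBoxCrossing → SmirnovBasePoint → QuarterTurnPinning → CrudeToCanonical → CardyFormulaZ2. -/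
theorem closesRectPointwise : SegmentOpenRect → UniformMarginalityRect → PointwiseBoxCrossing → SmirnovBasePoint →
    QuarterTurnPinning → CrudeToCanonical → _root_.CardyFormulaZ2 :=
  fun hO hM hP hS hQ hC =>
    closes_of_rectilinearMarginality hO hM (uniformBoxCrossing_of_uniformMarginalityRect_of_pointwise hM hP) hS hQ hC

/-- With the three dictionary/endpoint cruxes discharged by their tree proofs: CardyFormulaZ2 ⇐ SegmentOpen_rect ∧ UM_rect ∧
PointwiseBoxCrossing. -/
theorem cardyFormulaZ2_of_restated : SegmentOpenRect → UniformMarginalityRect → PointwiseBoxCrossing → _root_.CardyFormulaZ2 :=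
  fun hO hM hP => cardyFormulaZ2_of_rectilinearCruxes_pointwise hO hM hP

end Summit.CriticalPhenomena.CardyFormulaZ2.Cruxes.UniformMarginality.HeatFlow.RestatementPointwise

end
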